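import Literature.NumberTheory.EllipticCurves.NeronModelExistenceProofs
import Literature.NumberTheory.EllipticCurves.NeronModelAbelianSchemeProofs
import Literature.NumberTheory.EllipticCurves.NeronModelOnePrimeDescent
import HarnessLib

/-!
# Néron's existence theorem over a Dedekind domain follows from the local case (proved reduction)

Bosch–Lütkebohmert–Raynaud, *Néron Models*, §1.4, Thm. 1.4/3 (global existence over a Dedekind
scheme) is deduced there from the local existence theorem Cor. 1.3/2 (abelian varieties over
the fraction field of a discrete valuation ring have Néron models) by spreading the abelian
variety out to an abelian scheme over a dense open subscheme and gluing in the finitely many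
local Néron models; M. Artin, *Néron Models*, proof of Thm. (1.2), p. 228: "Clearly, we may
assume `R` local".

The tree records this deduction as the assembly theorem
`Literature.NumberTheory.EllipticCurves.exists_isNeronModel_of_dvr_of_glue h5 h7 h8 h6`
(`NeronModelExistence`), with the local existence theorem as hypothesis `h5` and the three
leaves of the global step as hypotheses `h7` (spreading out, the named fact
`exists_abelianScheme_away`), `h8` (proper smooth group schemes over a Dedekind domain are Néron
models of their generic fibres, BLR 1.2/8) and `h6` (gluing local Néron models, the named fact
`exists_isNeronModel_of_away_of_atPrime`). All three leaves are now PROVED in the tree —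
`exists_abelianScheme_away_holds` (`NeronModelExistenceProofs`),
`isNeronModel_of_isProper_of_smooth` (`NeronModelAbelianSchemeProofs`),
`exists_isNeronModel_of_away_of_atPrime_holds` (`NeronModelOnePrimeDescent`) — so the
local-to-global step of Néron's theorem is a theorem: `exists_isNeronModel_of_dvr`, **Néron
models of abelian varieties exist over every Dedekind domain as soon as they exist over every
discrete valuation ring**. What remains of the named fact
`Literature.NumberTheory.EllipticCurves.exists_isNeronModel` (Néron 1964; BLR Thm. 1.4/3) is
exactly its restriction to discrete valuation rings (BLR Cor. 1.3/2; Artin Thm. (1.2) for `R`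
local: the smoothening process, weak Néron models, birational group laws and descent from the
strict henselisation, BLR Chapters 3–6), which is deliberately not a separate named fact
(`NeronModelExistence`, module docstring). No named facts or definitions are introduced here
(D-0026).

## References

* S. Bosch, W. Lütkebohmert, M. Raynaud, *Néron Models*, Springer 1990, Prop. 1.2/8,
  Cor. 1.3/2, §1.4, Thm. 1.4/3. [BLRNeronModels1990] (Not held; numbers as confirmed by
  B. Poonen, *Rational Points on Varieties*, Thm. 5.7.25 and Rem. 5.7.27.)
* M. Artin, *Néron Models*, in G. Cornell, J. H. Silverman (eds.), *Arithmetic Geometry*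
  (Storrs 1984), Springer 1986, Thm. (1.2) and its proof (p. 228). [Artin1986NeronModels]
* A. Néron, *Modèles minimaux des variétés abéliennes sur les corps locaux et globaux*,
  Publ. Math. IHÉS 21 (1964), 5–128. [Neron1964]
-/

noncomputable section

universe u

namespace Literature.NumberTheory.EllipticCurves

open _root_.AlgebraicGeometry CategoryTheory

/-- **Néron's theorem over Dedekind domains from the local case** (BLR, proof of Thm. 1.4/3
from Cor. 1.3/2; Artin, proof of Thm. (1.2), p. 228: "Clearly, we may assume `R` local"): if
every abelian variety over the fraction field of a discrete valuation ring has a Néron model,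
then every abelian variety over the fraction field `K` of a Dedekind domain `R` has a Néron model
over `R`. This is `exists_isNeronModel_of_dvr_of_glue` with its three global hypotheses
discharged by the tree's theorems `exists_abelianScheme_away_holds` (spreading out to a proper
smooth group scheme over some `R[1/f]`, Milne Rem. 20.9), `isNeronModel_of_isProper_of_smooth`
(BLR 1.2/8) and `exists_isNeronModel_of_away_of_atPrime_holds` (gluing, BLR §1.4).
[cite: BLRNeronModels1990, Thm. 1.4/3 (proof, from Cor. 1.3/2)]
[cite: Artin1986NeronModels, proof of Thm. (1.2) (p. 228)] -/
theorem exists_isNeronModel_of_dvr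
    (h5 : ∀ (R : Type u) [CommRing R] [IsDomain R] [IsDiscreteValuationRing R] (K : Type u)
      [Field K] [Algebra R K] [IsFractionRing R K], exists_isNeronModel R K)
    (R : Type u) [CommRing R] [IsDedekindDomain R] (K : Type u) [Field K] [Algebra R K]
    [IsFractionRing R K] : exists_isNeronModel R K :=
  exists_isNeronModel_of_dvr_of_glue h5 exists_abelianScheme_away_holds
    (fun R _ _ K _ _ _ 𝒜 _ _ _ => isNeronModel_of_isProper_of_smooth R K 𝒜)
    exists_isNeronModel_of_away_of_atPrime_holds R K

/-- The same reduction with the local case in pointwise form: to give a Néron model of a fixed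
abelian variety `E` over the fraction field `K` of a Dedekind domain `R` it is enough to know
the local existence theorem (for all discrete valuation rings, in the universe of `R`).
Immediate from `exists_isNeronModel_of_dvr`. [cite: BLRNeronModels1990, Thm. 1.4/3 (proof, from Cor. 1.3/2)] -/
theorem exists_grp_isNeronModel_of_dvr
    (h5 : ∀ (R : Type u) [CommRing R] [IsDomain R] [IsDiscreteValuationRing R] (K : Type u)
      [Field K] [Algebra R K] [IsFractionRing R K], exists_isNeronModel R K)
    (R : Type u) [CommRing R] [IsDedekindDomain R] (K : Type u) [Field K] [Algebra R K]
    [IsFractionRing R K] (E : Over (Spec (.of K))) [GrpObj E] [IsProper E.hom]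
    [GeometricallyIntegral E.hom] :
    ∃ 𝒩 : Grp (Over (Spec (.of R))), IsNeronModel R K 𝒩.X E :=
  exists_isNeronModel_of_dvr h5 R K E

end Literature.NumberTheory.EllipticCurves

end
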